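import Mathlib
import Summits.NavierStokesRegularity.FluidComputer.TransportGalerkinRapid
import Summits.NavierStokesRegularity.FluidComputer.GalerkinLatticeOneSided
import HarnessLib

/-!
# The transport Galerkin model: condition (C2) with one constant from the box suprema (instab g17, cell `ns-blowup`, 2026-08-27)

HONEST FRAMING (human ruling D-0035): nothing here is a claim about Navier–Stokes blow-up.
WHAT THIS IS NOT: not NS evidence — the (C2) half of the model instance «(β2)» of the R-β emergence
chain (`HOME/instab/BETA2-SPEC.md` §5/§5′): for the field `nsField ν Uv π P = linOp + bilOp(·,·)` of
`TransportGalerkinDefs` on the `H²`-scaled lattice phase space and the set `W = box ρ π P`,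

* §3 the four hypotheses of `GalerkinLatticeOneSided.galerkin_oneSided_lattice` on the truncated
  elements `⋃_k P_k '' W`: `hA` from `TransportLinearisedLattice.re_pairing_wmul_two_linearised_le`
  (Leray symbol dropped by `TransportSkewLattice.pairing_apply_eq_of_isSelfAdjoint` against the
  `P`-fixed difference), `hsplit` by bilinearity, `hfirst` from
  `TransportCommutatorLattice.eNormSq_two_transport_le`, `htransport` from
  `TransportSkewLattice.abs_re_pairing_wmul_two_transport_le'` (reality and divergence-freeness of
  the advecting truncated element are the `box` clauses, `comp_unscale_real` / `comp_unscale_div`);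
* §4 `oneSided_nsField` — condition (C2) of `Literature.Analysis.ODE.GalerkinConvergenceSetting`:
  for every level `n`, `OneSidedLipschitzOnWith l (fun y => cubeProj n (nsField ν Uv π P y))
  (cubeProj n '' box ρ π P)` with ONE constant
  `l = ω₀ + 10π·card d·R₁`, `R₁ = ∑_l ⟨l⟩ρ_l`, `ω₀ = 6π ∑_j A₂(scal (π_j∘Uv)) + 4π·card d·A₃(Uv)`.

Hypotheses on the host: `ν ≥ 0`, `Uv` rapidly decreasing, real and divergence-free through `π`,
`‖π_j‖ ≤ 1`, `P(k)` self-adjoint of norm `≤ 1`; on the box: `ρ ≥ 0`, `∑_l ⟨l⟩ρ_l < ∞`.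
Mathlib + the tree files cited; no new definitions.
-/

noncomputable section

namespace Summit.NavierStokesRegularity.FluidComputer.TransportGalerkinOneSided

open Set Filter Topology Finset
open Literature.Analysis.FunctionSpaces Literature.Analysis.FunctionSpaces.Lattice
open Literature.Analysis.FunctionSpaces.Torus Literature.Analysis.ODE
open Summit.NavierStokesRegularity.FluidComputer.GalerkinLatticePhaseSpace
open Summit.NavierStokesRegularity.FluidComputer.TransportGalerkin
open Summit.NavierStokesRegularity.FluidComputer.TransportGalerkinBox
open Summit.NavierStokesRegularity.FluidComputer.TransportCommutatorLattice
open Summit.NavierStokesRegularity.FluidComputer.TransportSkewLattice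
open Summit.NavierStokesRegularity.FluidComputer.TransportLinearisedLattice
open Summit.NavierStokesRegularity.FluidComputer.TransportGalerkinRapid
open Summit.NavierStokesRegularity.FluidComputer.GalerkinLatticeOneSided
open scoped ENNReal NNReal ComplexConjugate InnerProductSpace

variable {d : Type*} [Fintype d] [DecidableEq d]
variable {V : Type*} [NormedAddCommGroup V] [InnerProductSpace ℂ V] [CompleteSpace V]

/-! ## §3 The four hypotheses of `galerkin_oneSided_lattice` on the truncated elements -/

section Hypotheses

omit [DecidableEq d] [CompleteSpace V] in
/-- `Λ² Λ⁻² = 1`. -/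
theorem wmul_two_wmul_neg_two (c : (d → ℤ) → V) : wmul 2 (wmul (-2) c) = c := by
  rw [wmul_wmul]; norm_num

omit [DecidableEq d] [CompleteSpace V] in
/-- `Λ⁻² Λ² = 1`. -/
theorem wmul_neg_two_wmul_two (c : (d → ℤ) → V) : wmul (-2) (wmul 2 c) = c := by
  rw [wmul_wmul]; norm_num

omit [DecidableEq d] [CompleteSpace V] in
/-- The scaled difference: `⇑(x − y) = Λ² (Λ⁻² ⇑x − Λ⁻² ⇑y)`. -/
theorem coe_sub_eq_wmul (x y : lp (fun _ : (d → ℤ) => V) 2) :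
    ⇑(x - y) = wmul 2 (wmul (-2) ⇑x - wmul (-2) ⇑y) := by
  rw [← wmul_sub, wmul_two_wmul_neg_two, lp.coeFn_sub]

omit [DecidableEq d] [CompleteSpace V] in
/-- `‖x − y‖² = ‖Λ⁻² ⇑x − Λ⁻² ⇑y‖₂²` (the `E`-norm is the `H²` norm of the unscaled families). -/
theorem norm_sub_sq_eq (x y : lp (fun _ : (d → ℤ) => V) 2) :
    ‖x - y‖ ^ 2 = (eNormSq 2 (wmul (-2) ⇑x - wmul (-2) ⇑y)).toReal := by
  rw [norm_sq_eq_toReal_eNormSq_zero, coe_sub_eq_wmul, eNormSq_wmul, zero_add]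

omit [DecidableEq d] [CompleteSpace V] in
/-- Unscaled differences of elements of `E` lie in `H²` (hence the toReal's are honest). -/
theorem eNormSq_two_unscale_sub_lt_top (x y : lp (fun _ : (d → ℤ) => V) 2) :
    eNormSq 2 (wmul (-2) ⇑x - wmul (-2) ⇑y) < ∞ := by
  have h := eNormSq_zero_coe_lt_top (x - y)
  rwa [coe_sub_eq_wmul, eNormSq_wmul, zero_add] at h

omit [DecidableEq d] [CompleteSpace V] in
/-- A box element is fixed modewise by `P` after unscaling, and so is any `Λ²`-rescaling. -/
theorem apply_coe_sub_eq {ρ : (d → ℤ) → ℝ} {π : d → (V →L[ℂ] ℂ)} {P : (d → ℤ) → (V →L[ℂ] V)}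
    {x y : lp (fun _ : (d → ℤ) => V) 2} (hx : x ∈ box ρ π P) (hy : y ∈ box ρ π P) (k : d → ℤ) :
    P k ((⇑x - ⇑y) k) = (⇑x - ⇑y) k := by
  rw [Pi.sub_apply, map_sub, hx.2.1 k, hy.2.1 k]

omit [DecidableEq d] [CompleteSpace V] in
/-- `Λ²` commutes with a modewise linear family. -/
theorem wmul_apply_comm (P : (d → ℤ) → (V →L[ℂ] V)) (s : ℝ) (f : (d → ℤ) → V) :
    (wmul s fun k => P k (f k)) = fun k => P k (wmul s f k) := by
  funext k; rw [wmul_apply, wmul_apply, map_smul]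

variable {ρ : (d → ℤ) → ℝ} {ν : ℝ} {Uv : (d → ℤ) → V} {π : d → (V →L[ℂ] ℂ)} {P : (d → ℤ) → (V →L[ℂ] V)}

omit [DecidableEq d] [CompleteSpace V] in
/-- The advecting components of an unscaled box element are REAL: `π_j (v (−p)) = conj (π_j (v p))`. -/
theorem comp_unscale_real {x : lp (fun _ : (d → ℤ) => V) 2} (hx : x ∈ box ρ π P) (j : d) (p : d → ℤ) :
    (fun p => π j (wmul (-2) (⇑x) p)) (-p) = conj ((fun p => π j (wmul (-2) (⇑x) p)) p) := by
  simp only [wmul_apply, map_smul, smul_eq_mul, map_mul, Complex.conj_ofReal]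
  rw [hx.2.2.1 j p, sobolevWeight, sobolevWeight, freqNormSq_neg]

omit [DecidableEq d] [CompleteSpace V] in
/-- The advecting components of an unscaled box element are DIVERGENCE-FREE: `∑_j ∂_j (π_j ∘ v) = 0`. -/
theorem comp_unscale_div {x : lp (fun _ : (d → ℤ) => V) 2} (hx : x ∈ box ρ π P) :
    ∑ j, freqDeriv j (fun p => π j (wmul (-2) (⇑x) p)) = 0 := by
  funext p
  rw [Finset.sum_apply, Pi.zero_apply]
  have h : ∀ j, freqDeriv j (fun p => π j (wmul (-2) (⇑x) p)) p =
      (2 * Real.pi * Complex.I * (sobolevWeight (-2) p : ℂ)) * (((p j : ℤ) : ℂ) * π j (x p)) := fun j => by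
    rw [freqDeriv_apply, wmul_apply, map_smul, smul_eq_mul, smul_eq_mul]; ring
  simp only [h, ← Finset.mul_sum, hx.2.2.2 p, mul_zero]

/-- **`hA`** on the truncated elements: `Re ⟨A x − A y, x − y⟩ ≤ ω₀ ‖x − y‖²` with the host constant
`ω₀ = 6π ∑_j A₂(scal (π_j ∘ Uv)) + 4π·card d·A₃(Uv)` (part III, Leray symbol dropped against the
`P`-fixed difference). -/
theorem hA_trunc (hν : 0 ≤ ν) (hUv : RapidDecay Uv) (hUreal : ∀ j p, π j (Uv (-p)) = conj (π j (Uv p)))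
    (hUdiv : ∑ j, freqDeriv j (fun p => π j (Uv p)) = 0) (hπ : ∀ j, ‖π j‖ ≤ 1)
    (hPsa : ∀ k, IsSelfAdjoint (P k)) (hPn : ∀ k, ‖P k‖ ≤ 1)
    {x : lp (fun _ : (d → ℤ) => V) 2} (hx : x ∈ ⋃ k : ℕ, cubeProj k '' box ρ π P)
    {y : lp (fun _ : (d → ℤ) => V) 2} (hy : y ∈ ⋃ k : ℕ, cubeProj k '' box ρ π P) :
    (pairing (⇑(linOp ν Uv π P x - linOp ν Uv π P y)) (⇑(x - y))).re ≤
      (6 * Real.pi * (∑ j, (symbNorm 2 (scal (fun p => π j (Uv p)) : (d → ℤ) → (V →L[ℂ] V))).toReal)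
        + 2 * ((Fintype.card d : ℝ) * (2 * Real.pi)) *
          (∑' l, ENNReal.ofReal (sobolevWeight 3 l) * ‖Uv l‖ₑ).toReal) * ‖x - y‖ ^ 2 := by
  have hxW := mem_box_of_mem_iUnion hx
  have hyW := mem_box_of_mem_iUnion hy
  have hxr := rapidDecay_wmul (rapidDecay_of_mem_iUnion hx) (-2)
  have hyr := rapidDecay_wmul (rapidDecay_of_mem_iUnion hy) (-2)
  set w := wmul (-2) ⇑x - wmul (-2) ⇑y with hw
  have hwr : RapidDecay w := RapidDecay.sub' hxr hyr
  -- the coefficients of `A x − A y`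
  have hcoe : ⇑(linOp ν Uv π P x - linOp ν Uv π P y) =
      fun k => P k (wmul 2 (linCoeff ν Uv π w) k) := by
    rw [lp.coeFn_sub, coe_linOp_of_rapidDecay hUv hPn (rapidDecay_of_mem_iUnion hx),
      coe_linOp_of_rapidDecay hUv hPn (rapidDecay_of_mem_iUnion hy)]
    have hlin := linCoeff_sub (ν := ν) hUv π hxr hyr
    rw [← hw] at hlin
    funext k
    have hk := congrFun hlin k
    simp only [Pi.sub_apply] at hk
    simp only [Pi.sub_apply, wmul_apply, map_smul, hk, map_sub, smul_sub]
  have hfix : ∀ k, P k (wmul 2 w k) = wmul 2 w k := fun k => by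
    rw [hw, ← coe_sub_eq_wmul]; exact apply_coe_sub_eq hxW hyW k
  rw [hcoe, coe_sub_eq_wmul, ← hw, pairing_apply_eq_of_isSelfAdjoint P hPsa _ _ hfix, linCoeff_eq,
    norm_sub_sq_eq, ← hw, ← toReal_eNorm_sq]
  exact re_pairing_wmul_two_linearised_le (V := V) hν (fun j p => π j (Uv p))
    (fun j => hUv.comp_apply (π j)) hUreal hUdiv Uv (tsum_weight_mul_enorm_lt_top hUv 3) π hπ
    (eNormSq_lt_top_of_rapidDecay hwr 3)

/-- **`hsplit`** on the truncated elements: `B x x − B y y = B (x − y) x + B y (x − y)` in `E`. -/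
theorem hsplit_trunc (hPn : ∀ k, ‖P k‖ ≤ 1)
    {x : lp (fun _ : (d → ℤ) => V) 2} (hx : x ∈ ⋃ k : ℕ, cubeProj k '' box ρ π P)
    {y : lp (fun _ : (d → ℤ) => V) 2} (hy : y ∈ ⋃ k : ℕ, cubeProj k '' box ρ π P) :
    bilOp π P x x - bilOp π P y y = bilOp π P (x - y) x + bilOp π P y (x - y) := by
  have hxr0 := rapidDecay_of_mem_iUnion hx
  have hyr0 := rapidDecay_of_mem_iUnion hy
  have hxyr0 : RapidDecay (⇑(x - y)) := by rw [lp.coeFn_sub]; exact RapidDecay.sub' hxr0 hyr0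
  have hxr := rapidDecay_wmul hxr0 (-2)
  have hyr := rapidDecay_wmul hyr0 (-2)
  have hsplit := bilCoeff_sub_split π hxr hyr
  refine lp.ext ?_
  rw [lp.coeFn_sub, lp.coeFn_add, coe_bilOp_of_rapidDecay hPn hxr0 hxr0,
    coe_bilOp_of_rapidDecay hPn hyr0 hyr0, coe_bilOp_of_rapidDecay hPn hxyr0 hxr0,
    coe_bilOp_of_rapidDecay hPn hyr0 hxyr0, lp.coeFn_sub, wmul_sub]
  funext k
  have hk := congrFun hsplit k
  simp only [Pi.sub_apply, Pi.add_apply] at hk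
  simp only [Pi.sub_apply, Pi.add_apply, wmul_apply, ← smul_sub, ← smul_add, ← map_sub, ← map_add, hk]

/-- **`hfirst`** on the truncated elements: `‖B (x − y) x‖ ≤ 4π·card d·R₁·‖x − y‖`, `R₁ = ∑_l ⟨l⟩ρ_l`
(part I's first-slot bound, the Leray symbol a modewise contraction). -/
theorem hfirst_trunc (hρ0 : ∀ k, 0 ≤ ρ k) (hρ1 : Summable fun k => sobolevWeight 1 k * ρ k)
    (hπ : ∀ j, ‖π j‖ ≤ 1) (hPn : ∀ k, ‖P k‖ ≤ 1)
    {x : lp (fun _ : (d → ℤ) => V) 2} (hx : x ∈ ⋃ k : ℕ, cubeProj k '' box ρ π P)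
    {y : lp (fun _ : (d → ℤ) => V) 2} (hy : y ∈ ⋃ k : ℕ, cubeProj k '' box ρ π P) :
    ‖bilOp π P (x - y) x‖ ≤
      2 * ((Fintype.card d : ℝ) * (2 * Real.pi)) * (∑' l, sobolevWeight 1 l * ρ l) * ‖x - y‖ := by
  have hxW := mem_box_of_mem_iUnion hx
  have hxr0 := rapidDecay_of_mem_iUnion hx
  have hyr0 := rapidDecay_of_mem_iUnion hy
  have hxyr0 : RapidDecay (⇑(x - y)) := by rw [lp.coeFn_sub]; exact RapidDecay.sub' hxr0 hyr0
  set R₁ := ∑' l, sobolevWeight 1 l * ρ l with hR₁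
  have hR₁0 : 0 ≤ R₁ := tsum_nonneg fun l => mul_nonneg (sobolevWeight_pos _ _).le (hρ0 l)
  set w := wmul (-2) ⇑x - wmul (-2) ⇑y with hw
  set u := wmul (-2) ⇑x with hu
  set C : ℝ≥0∞ := (Fintype.card d : ℝ≥0∞) * ENNReal.ofReal (2 * Real.pi) with hC
  -- `‖B (x − y) x‖² ≤ (2 C R₁)² ‖x − y‖²` in `ℝ≥0∞`
  have hA₃ := weightThree_unscale_le hρ0 hρ1 hxW
  have hsq : eNormSq 0 (⇑(bilOp π P (x - y) x)) ≤
      4 * C ^ 2 * ENNReal.ofReal R₁ ^ 2 * eNormSq 2 w := by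
    rw [coe_bilOp_of_rapidDecay hPn hxyr0 hxr0, eNormSq_wmul, zero_add, coe_sub_eq_wmul,
      wmul_neg_two_wmul_two, ← hu, ← hw, bilCoeff_eq]
    refine (eNormSq_apply_le_of_opNorm_le_one P hPn 2 _).trans ?_
    rw [eNormSq_neg]
    refine (eNormSq_two_transport_le (fun j p => π j (w p)) w (norm_comp_le π hπ w) u).trans ?_
    gcongr
  -- pass to real numbers
  have hfin : 4 * C ^ 2 * ENNReal.ofReal R₁ ^ 2 * eNormSq 2 w ≠ ∞ :=
    ENNReal.mul_ne_top (ENNReal.mul_ne_top (ENNReal.mul_ne_top (by norm_num)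
      (ENNReal.pow_ne_top (ENNReal.mul_ne_top (by simp) ENNReal.ofReal_ne_top)))
      (ENNReal.pow_ne_top ENNReal.ofReal_ne_top)) (eNormSq_two_unscale_sub_lt_top x y).ne
  have hreal : ‖bilOp π P (x - y) x‖ ^ 2 ≤
      (2 * ((Fintype.card d : ℝ) * (2 * Real.pi)) * R₁ * ‖x - y‖) ^ 2 := by
    have h := ENNReal.toReal_mono hfin hsq
    rw [← norm_sq_eq_toReal_eNormSq_zero, ENNReal.toReal_mul, ENNReal.toReal_mul, ENNReal.toReal_mul,
      ← norm_sub_sq_eq, ENNReal.toReal_pow, ENNReal.toReal_pow, ENNReal.toReal_ofReal hR₁0, hC,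
      ENNReal.toReal_mul, ENNReal.toReal_ofReal (by positivity), ENNReal.toReal_natCast,
      show (4 : ℝ≥0∞).toReal = 4 by norm_num] at h
    calc ‖bilOp π P (x - y) x‖ ^ 2
        ≤ 4 * ((Fintype.card d : ℝ) * (2 * Real.pi)) ^ 2 * R₁ ^ 2 * ‖x - y‖ ^ 2 := h
      _ = (2 * ((Fintype.card d : ℝ) * (2 * Real.pi)) * R₁ * ‖x - y‖) ^ 2 := by ring
  exact (pow_le_pow_iff_left₀ (norm_nonneg _) (by positivity) two_ne_zero).1 hreal

/-- **`htransport`** on the truncated elements: `Re ⟨B y (x − y), x − y⟩ ≤ 6π·card d·R₁·‖x − y‖²`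
(part II's transport form: the advecting unscaled box element is real and divergence-free; Leray
symbol dropped against the `P`-fixed difference). -/
theorem htransport_trunc (hρ0 : ∀ k, 0 ≤ ρ k) (hρ1 : Summable fun k => sobolevWeight 1 k * ρ k)
    (hπ : ∀ j, ‖π j‖ ≤ 1) (hPsa : ∀ k, IsSelfAdjoint (P k)) (hPn : ∀ k, ‖P k‖ ≤ 1)
    {x : lp (fun _ : (d → ℤ) => V) 2} (hx : x ∈ ⋃ k : ℕ, cubeProj k '' box ρ π P)
    {y : lp (fun _ : (d → ℤ) => V) 2} (hy : y ∈ ⋃ k : ℕ, cubeProj k '' box ρ π P) :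
    (pairing (⇑(bilOp π P y (x - y))) (⇑(x - y))).re ≤
      6 * Real.pi * ((Fintype.card d : ℝ) * (∑' l, sobolevWeight 1 l * ρ l)) * ‖x - y‖ ^ 2 := by
  have hxW := mem_box_of_mem_iUnion hx
  have hyW := mem_box_of_mem_iUnion hy
  have hxr0 := rapidDecay_of_mem_iUnion hx
  have hyr0 := rapidDecay_of_mem_iUnion hy
  have hxyr0 : RapidDecay (⇑(x - y)) := by rw [lp.coeFn_sub]; exact RapidDecay.sub' hxr0 hyr0
  have hyr := rapidDecay_wmul hyr0 (-2)
  set R₁ := ∑' l, sobolevWeight 1 l * ρ l with hR₁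
  have hR₁0 : 0 ≤ R₁ := tsum_nonneg fun l => mul_nonneg (sobolevWeight_pos _ _).le (hρ0 l)
  set w := wmul (-2) ⇑x - wmul (-2) ⇑y with hw
  set v := wmul (-2) ⇑y with hv
  have hwr : RapidDecay w := RapidDecay.sub' (rapidDecay_wmul hxr0 (-2)) hyr
  -- coefficients of `B y (x − y)`
  have hcoe : ⇑(bilOp π P y (x - y)) =
      fun k => P k (wmul 2 (-(∑ j, conv (scal (fun p => π j (v p))) (freqDeriv j w))) k) := by
    rw [coe_bilOp_of_rapidDecay hPn hyr0 hxyr0, coe_sub_eq_wmul, wmul_neg_two_wmul_two, ← hv, ← hw,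
      bilCoeff_eq, wmul_apply_comm]
  have hfix : ∀ k, P k (wmul 2 w k) = wmul 2 w k := fun k => by
    rw [hw, ← coe_sub_eq_wmul]; exact apply_coe_sub_eq hxW hyW k
  have hneg : wmul 2 (-(∑ j, conv (scal (fun p => π j (v p)) : (d → ℤ) → (V →L[ℂ] V)) (freqDeriv j w))) =
      -wmul 2 (∑ j, conv (scal (fun p => π j (v p))) (freqDeriv j w)) := by
    funext k; simp only [wmul_apply, Pi.neg_apply, smul_neg]
  rw [hcoe, coe_sub_eq_wmul, ← hw, pairing_apply_eq_of_isSelfAdjoint P hPsa _ _ hfix, hneg,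
    pairing_neg_left, Complex.neg_re, norm_sub_sq_eq, ← hw]
  -- part II
  have h2 := abs_re_pairing_wmul_two_transport_le' (fun j p => π j (v p))
    (fun j => hyr.comp_apply (π j)) (comp_unscale_real hyW) (comp_unscale_div hyW)
    (eNormSq_lt_top_of_rapidDecay hwr 3)
  have hsum : (∑ j, (symbNorm 2 (scal (fun p => π j (v p)) : (d → ℤ) → (V →L[ℂ] V))).toReal) ≤
      (Fintype.card d : ℝ) * R₁ := by
    calc (∑ j, (symbNorm 2 (scal (fun p => π j (v p)) : (d → ℤ) → (V →L[ℂ] V))).toReal)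
        ≤ ∑ _j : d, R₁ := Finset.sum_le_sum fun j _ =>
          ENNReal.toReal_le_of_le_ofReal hR₁0 (symbNorm_two_scal_comp_le hρ0 hρ1 hπ hyW j)
      _ = (Fintype.card d : ℝ) * R₁ := by rw [Finset.sum_const, Finset.card_univ, nsmul_eq_mul]
  have hn : 0 ≤ (eNormSq 2 w).toReal := ENNReal.toReal_nonneg
  calc -(pairing (wmul 2 (∑ j, conv (scal (fun p => π j (v p))) (freqDeriv j w))) (wmul 2 w)).re
      ≤ 6 * Real.pi * (∑ j, (symbNorm 2 (scal (fun p => π j (v p)) : (d → ℤ) → (V →L[ℂ] V))).toReal) *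
          (eNormSq 2 w).toReal := (neg_le_abs _).trans h2
    _ ≤ 6 * Real.pi * ((Fintype.card d : ℝ) * R₁) * (eNormSq 2 w).toReal := by
        gcongr

end Hypotheses

/-! ## §4 Condition (C2) for the model -/

/-- **CONDITION (C2) OF THE GALERKIN CONVERGENCE SETTING FOR THE TRANSPORT MODEL, ONE CONSTANT FOR ALL
LEVELS.** For `ν ≥ 0`, a rapidly decreasing host `Uv` that is real and divergence-free through the
norm-`≤ 1` functionals `π_j`, a modewise self-adjoint contraction `P` (the Leray symbol), and radii
`ρ ≥ 0` with `R₁ = ∑_l ⟨l⟩ρ_l < ∞`: for every level `n`, the truncated field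
`y ↦ P_n (nsField ν Uv π P y)` is one-sided Lipschitz on `P_n '' W`, `W = box ρ π P`, with the constant
`l = ω₀ + 10π·card d·R₁`, `ω₀ = 6π ∑_j A₂(scal (π_j ∘ Uv)) + 4π·card d·A₃(Uv)` — the field `oneSided`
of `Literature.Analysis.ODE.GalerkinConvergenceSetting` (via `GalerkinLatticeOneSided.galerkin_oneSided_lattice`). -/
theorem oneSided_nsField {ρ : (d → ℤ) → ℝ} {ν : ℝ} {Uv : (d → ℤ) → V} {π : d → (V →L[ℂ] ℂ)}
    {P : (d → ℤ) → (V →L[ℂ] V)} (hν : 0 ≤ ν) (hUv : RapidDecay Uv)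
    (hUreal : ∀ j p, π j (Uv (-p)) = conj (π j (Uv p)))
    (hUdiv : ∑ j, freqDeriv j (fun p => π j (Uv p)) = 0) (hπ : ∀ j, ‖π j‖ ≤ 1)
    (hPsa : ∀ k, IsSelfAdjoint (P k)) (hPn : ∀ k, ‖P k‖ ≤ 1)
    (hρ0 : ∀ k, 0 ≤ ρ k) (hρ1 : Summable fun k => sobolevWeight 1 k * ρ k) (n : ℕ) :
    OneSidedLipschitzOnWith
      ((6 * Real.pi * (∑ j, (symbNorm 2 (scal (fun p => π j (Uv p)) : (d → ℤ) → (V →L[ℂ] V))).toReal)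
        + 2 * ((Fintype.card d : ℝ) * (2 * Real.pi)) *
          (∑' l, ENNReal.ofReal (sobolevWeight 3 l) * ‖Uv l‖ₑ).toReal)
        + 10 * Real.pi * (Fintype.card d : ℝ) * (∑' l, sobolevWeight 1 l * ρ l))
      (fun y => cubeProj n (nsField ν Uv π P y)) (cubeProj n '' box ρ π P) := by
  have h := galerkin_oneSided_lattice (W := box ρ π P) (A := linOp ν Uv π P) (B := bilOp π P)
    (fun x hx y hy => hA_trunc hν hUv hUreal hUdiv hπ hPsa hPn hx hy)
    (fun x hx y hy => hsplit_trunc hPn hx hy)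
    (fun x hx y hy => hfirst_trunc hρ0 hρ1 hπ hPn hx hy)
    (fun x hx y hy => htransport_trunc hρ0 hρ1 hπ hPsa hPn hx hy) n
  refine h.mono_const (le_of_eq ?_)
  ring

end Summit.NavierStokesRegularity.FluidComputer.TransportGalerkinOneSided

end
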